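import Summits.QuantumFields.YangMills.Theorems.BalabanUVNodesPortS1GaugeFixSmooth
import Summits.QuantumFields.YangMills.Theorems.BalabanUVNodesPortS1LZHalfRegT8
import Summits.QuantumFields.YangMills.Theorems.BalabanUVNodesPortS1G3CCollect
import Summits.QuantumFields.YangMills.Theorems.BalabanUVNodesPortS1LZdetGeom
import Summits.QuantumFields.YangMills.Theorems.BalabanUVNodesN18TorusDomainCover
import Summits.QuantumFields.YangMills.Theorems.BalabanUVNodesPortS1ClosingFrameT8
import Summits.QuantumFields.YangMills.Theorems.BalabanUVNodesK0RecordFormatNamesLemmas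

/-!
# NODE O port PT-A — (M7) IS GLUE: `RegClassP5` (PosDef + upper form bound of the (2.11) matrix on print's ε₀-class) FROM the P0-ℂ letter's CLASS-WIDE rows
# (P5ᶜ) complex coercivity ∕ (P4) localisation + Schur decay, the (P2)-class letter, the nesting letter, and ONE P0-ℝ row — the selector is `C²` along the chart at
# every class point (`RegSelSmoothOnClass`, §0) — which is the SAME row the (M6-i) route needs (★★★ director-ym №667 (3))

Cell `ym-nodeO-ideate`, porter seat `ymgap-nodeO-port-PTA-1` (payload gen 12 ∕ lineage g13); `--supports stmt-QuantumFields-27930 --as helper`; count-neutral; definition kind (§0 ONE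
`def … : Prop`) + theorems.  [I] = [Balaban1987RG1]; [15] = [Balaban1985Variational]; [II] = [Balaban1988RG2Cluster].  This lineage's LOCATING MEMO (M6)∕(M7)
(`Lines/pta_residueW-LOCATING-M6-M7-v1.md`, ADOPTED №667 (1)) §2: «INSIDE THE TREE's LETTERS (M7-pos) IS NOT AN INDEPENDENT WALL … (M7) ⇐ P0C ∧ (M6) ∧ NEST ∧ (M7-sym-a)»; this file
is that glue, with the erratum of nodeO STATUS l.6479: the whole-torus domain `⊤` IS in the tree (✓`g3cFull`, ✓`N18TorusDomainCover.mem_domSites_univ`).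

THE ARGUMENT ([I] p.267–268 «positive definite operator C*Δ^{(k)}C», (1.18) p.263; [II] (1.26) p.8).  `P0HolExtAtRecordGL` at the DEMANDED rate `δ₀ := κ₀(64, 8) + 1` and the
antecedent's TokE guard gives carriers with `P0CarrierClauses` at radii `(α₀′, α₁′)`; `RegClassNestsUc` at `(α₀′, α₁′)`, `ClassP2Reg` at P0C's data and `RegSelSmoothOnClass` give class radii
`εN`, `ε₂`, `εA`; with the class-numerics radius `min (ε₁∕2) (1∕(53581824L⁶))` they combine by `min`.  At a class point: (M7-sym) by ✓`isHermitian_recordPreckLoc_portVkAx_of_inRegClass`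
(✓`…PortS1GaugeFixSmooth`, the gauge-fixing row discharged there); (M7-pos) = (P5ᶜ) at `X := ⊤` (`g3cFull`; support clause vacuous by `mem_domSites_univ`; `Σ_{Y ⊆ ⊤} TY = TC` by (P4).1;
`TY (pairCut ⊤ B) = TY (recordPairJ B)` by (P4).3 + ✓`agreeOnSet_pairCutTorusAt`) at the real vector `w`: `γ₀|w|² ≤ ⟨w, T(B)w⟩`; (M7-up) = an elementary Schur bound (§1) with the rows∕columns
of `T(B) = Re TC(recordPairJ B)|_{NonB0}` bounded by `Σ_{Y ∋ □(i)} c₀e^{−δ₀·dj Y} ≤ c₀·K₀(64, 8)` ((P4).2 support in cube form, (P4).3 at the cut pair of each `Y`, (P4).4 Schur decay, the anchored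
tree-graph sum ✓`treeLeaf_recordCc` = [II] (1.26)).  So `γ′ := c₀·K₀(64, 8)`.

WHAT THIS FILE PROVES (0 sorry; standard axioms).
* §0 `def RegSelSmoothOnClass (F) : Prop` — THE ONE P0-ℝ ROW (a′) of №667 (3), antecedent form (⁸ prefix byte-identical to ✓`RegClassP5` ∕ ✓`RegClassNestsUc`; tail `∀ ε₂₉ > 0, ∃ εA > 0,
  ∀ ε₀ ∈ (0, εA], ∀ k n B, InRegClass … ε₀ … B → ContDiffAt ℝ 2 (recordAUk F k K a₀ (portVkAx … B)) 0`): «the Wilson action through the level-`k` rooted selector along the chart `V′ ↦ V′·V^{(k)}_{ax}(W_B)`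
  is `C²` at `V′ = 1` at every point of the ε₀-class» — [15] Prop. 9 p.309 + p.307 L1–8 (analytic in `V′` near every regular `V₀`) read at the record's selector.  Asserted for nothing.
* §1 `dotProduct_mulVec_le_of_abs_row_col` (Schur for a real quadratic form), `sum_nonB0_le_sum`.  §2 `mem_domSites_g3cFull`, `agreeOnSet_recordPairJ_pairCut_g3cFull`,
  `TC_recordPairJ_eq_pairCut_g3cFull`, `sum_norm_TC_row_le`∕`_col_le` (rows∕columns of the carrier at the uncut pair of a point whose cut pairs lie in the record spaces: `≤ c₀·K₀(64,8)`).
* §3 ★★ `posLower_recordPreckLoc_of_P0C` ((M7-pos) at one point: `γ₀|w|² ≤ ⟨w, T(B)w⟩` from the carrier clauses, the (P2) identity at `B` and `CutsInUc … B`), ★★ `upper_recordPreckLoc_of_P0C`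
  ((M7-up) at one point: `⟨w, T(B)w⟩ ≤ c₀K₀|w|²`).
* §4 ★★★ `regClassP5_of_P0C_of_classP2_of_regNest_of_regSel : (∀F, P0HolExtAtRecordGL F) → (∀F, ClassP2Reg F) → (∀F, RegClassNestsUc F) → (∀F, RegSelSmoothOnClass F) → ∀F, RegClassP5 F`
  — `RegClassP5` LEAVES THE WALL: modulo the P0-ℂ letter, the (P2)-class letter and the nesting letter (all already on the wall) it costs exactly the selector row (a′).
* §5 ★★★ `portRecordRepresentationS1_of_regLetters_sel` — the closing frame ✓p832671 RE-KEYED: ⟨27930⟩ BY NAME from {`P0HolExtAtRecordGL`, `ClassP2Reg`, `RegSelSmoothOnClass`, `RegClassNestsUc`, `FEChartLawReg`, `FEPolymerActivitiesReg`, `FEPolymerResummation`}.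

HONEST FRAMING.  Glue (linear algebra + the tree's own combinatorial leaf) over DISPLAYED letters: `P0HolExtAtRecordGL` (the P0-ℂ wall), `ClassP2Reg`, `RegClassNestsUc`, `RegSelSmoothOnClass`
are inhabited NOWHERE; the new letter is P0-ℝ content ([15] Prop. 9 at general `V₀`), asserted for nothing; nothing of Bałaban's RG estimates is ported or discharged; the k-,U-uniform `γ₀`
of print ([I] p.267 → B9 p.428, GAPS G-B9-09) remains booked inside (P5ᶜ); ⟨27930⟩ OPEN 2∕7 · no claim; ⟨26900⟩ 0∕4; NODE O 0∕1; COUNT 8∕28 · K 1∕4 UNMOVED; finite `𝕋⁴_{L^K}` at fixed ε — NOT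
continuum ∕ OS; **the Yang–Mills mass gap (Clay) is NOT proved by any of this.**  No `sorry`, no `instance`; standard axioms only.
-/

noncomputable section

open scoped BigOperators Matrix.Norms.L2Operator Topology

namespace Summit.QuantumFields.YangMills.Theorems.BalabanUVNodesPortS1

open Summit.QuantumFields.YangMills.Theorems.K0RecordFormatNames
open Summit.QuantumFields.YangMills.BalabanUVNodes
open Literature.MathematicalPhysics.QuantumFieldTheory.Balaban1983to89
open Literature.MathematicalPhysics.QuantumFieldTheory.Balaban1983to89.Node00
open Literature.MathematicalPhysics.QuantumFieldTheory.Balaban1983to89.T4Continuum (T4Family)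
open Literature.MathematicalPhysics.QuantumFieldTheory.Balaban1983to89.B12TreeDecay (K₀ kappa₀ K₀_pos kappa₀_nonneg)
open Literature.MathematicalPhysics.QuantumFieldTheory.Balaban1983to89.TreeLengthTorus (TPt)
open _root_.Matrix _root_.Filter _root_.Finset

/-! ## §0  The ONE P0-ℝ row: the selector is `C²` along the chart at every class point -/
/-- ★★ **`RegSelSmoothOnClass F` — THE SELECTOR ROW (a′) OF ★★★ №667 (3), ANTECEDENT FORM**: under the signed antecedent of 27930⁸-Ax-LR4 (verbatim, as in ✓`RegClassP5` ∕ ✓`RegClassNestsUc`),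
for every `ε₂₉ > 0` there is ONE class radius `εA > 0` — after the antecedent's data and `ε₂₉`, BEFORE `ε₀ ≤ εA`, the level `k`, the volume index `n` and the class point `B` — such that at
every point `B` of every ε₀-regular class with `ε₀ ≤ εA` the Wilson action through the level-`k` ROOTED SELECTOR along the chart, `x ↦ A(U_k(V′_x · V^{(k)}_{ax}(W_B)))` = `recordAUk F k K a₀
(portVkAx … B)`, is `C²` at `x = 0` — print's «U_k(V) = U_k(V′V₀) … has an extension to an analytic function of Gᶜ-valued small configurations V′» ([15] Prop. 9) at `V₀ = V^{(k)}_{ax}(W_B)`, read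
at the record's selector in its weakest useful (C²) form.  The SAME row serves (M7-sym) (this file, via ✓`isHermitian_recordPreckLoc_portVkAx_of_inRegClass`) and the (M6-i) route of record
(the Lagrange-Hessian identity at class points, lit ✓`B11Eq177CriticalFamilyDerivative`).  INTENDED SUPPLIER: node00-def-Y (P0-ℝ; the `stub_P0C` shelf — same selector, same chart).
A `Prop`; asserted for nothing; inhabited nowhere. [cite: Balaban1985Variational, Prop. 9 p.309, p.307 L1–8, Thm 1 p.279; Balaban1987RG1, (2.6)–(2.8) p.266–267, (2.11) p.267, (1.1)–(1.2) p.260] -/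
def RegSelSmoothOnClass (F : T4Family) : Prop :=
  ∃ Mth : ℕ, ∀ Mc : ℕ, Mth ≤ Mc → ∀ (j c c₀ c₁ : ℕ) (B₃ B₃' a₀ a₁ : ℝ), Summit.QuantumFields.YangMills.Theorems.K0RecordFormatNames.McGuard F Mc → c ≤ F.L ^ j → c₀ ≤ j + 1 → c₁ ≤ j → 2 * (F.L : ℝ) ^ 2 ≤ B₃ → 0 < B₃' → 0 < a₀ → 0 < a₁ → Literature.MathematicalPhysics.QuantumFieldTheory.Balaban1983to89.Node00.VariationalThm1RegSepCoP7MGB F 2 (fun ν M g K k _s => c ≤ ν.M₁ ∧ k + c₀ ≤ F.m + K ∧ F.L ^ c₁ ∣ M ∧ ∀ i, 1 ≤ i → i ≤ k → Literature.MathematicalPhysics.QuantumFieldTheory.Balaban1983to89.Node00.dCubeSide (F.P K).L M (Literature.MathematicalPhysics.QuantumFieldTheory.Balaban1983to89.Node00.RkOfRecord (F.P K).L ν.r (g i)) i ∣ (F.P K).sitesPerDir 0) (Literature.MathematicalPhysics.QuantumFieldTheory.Balaban1983to89.Node00.lamDatum F) (Literature.MathematicalPhysics.QuantumFieldTheory.Balaban1983to89.Node00.dataSmall7LamTopOf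 F 2) B₃ a₀ a₁ → Literature.MathematicalPhysics.QuantumFieldTheory.Balaban1983to89.Node00.Gauge9RegSepTopStepGB F 2 (fun ν K Ω => Literature.MathematicalPhysics.QuantumFieldTheory.Balaban1983to89.Node00.suppDomOfRecord F ν K Ω) (F.L ^ j) (fun ν M g K k _s => c ≤ ν.M₁ ∧ k + c₀ ≤ F.m + K ∧ F.L ^ c₁ ∣ M ∧ ∀ i, 1 ≤ i → i ≤ k → Literature.MathematicalPhysics.QuantumFieldTheory.Balaban1983to89.Node00.dCubeSide (F.P K).L M (Literature.MathematicalPhysics.QuantumFieldTheory.Balaban1983to89.Node00.RkOfRecord (F.P K).L ν.r (g i)) i ∣ (F.P K).sitesPerDir 0) (Literature.MathematicalPhysics.QuantumFieldTheory.Balaban1983to89.Node00.lamDatum F) (Literature.MathematicalPhysics.QuantumFieldTheory.Balaban1983to89.Node00.dataSmall7LamTopOf F 2) B₃ B₃' a₀ a₁ → (∀ ε₁ : ℝ, 0 < ε₁ → ε₁ ≤ a₁ → B₃ * ε₁ ≤ a₀ → ∀ (k n : ℕ) (V : Literature.MathematicalPhysics.QuantumFieldTheory.Balaban1983to89.GaugeField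 (F.P (Summit.QuantumFields.YangMills.Theorems.K0RecordFormatNames.recordK₀ F Mc k + n)) (k + 1) (Literature.MathematicalPhysics.QuantumFieldTheory.Balaban1983to89.Node00.SU 2)), Literature.MathematicalPhysics.QuantumFieldTheory.Balaban1983to89.PlaqSmall ε₁ V → Literature.MathematicalPhysics.QuantumFieldTheory.Balaban1983to89.Node00.UkExists F 2 (Summit.QuantumFields.YangMills.Theorems.K0RecordFormatNames.recordK₀ F Mc k + n) (k + 1) a₀ V ∧ Literature.MathematicalPhysics.QuantumFieldTheory.Balaban1983to89.Node00.UniqueUkOrbit F 2 (Summit.QuantumFields.YangMills.Theorems.K0RecordFormatNames.recordK₀ F Mc k + n) (k + 1) a₀ V) → (∀ (k n : ℕ) (ε₂₉ : ℝ), 0 < ε₂₉ → letI θ := Summit.QuantumFields.YangMills.Theorems.K0RecordFormatNames.thetaFill F a₀ ε₂₉; letI := θ.instVβ₁; letI := θ.instVβ₂; letI := θ.instιβ; AnalyticAt ℝ (fun B : Summit.QuantumFields.YangMills.Theorems.K0RecordFormatNames.recordW F a₀ ε₂₉ k (Summit.QuantumFields.YangMills.Theorems.K0RecordFormatNames.recordK₀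 F Mc k + n) => fun (b : Literature.MathematicalPhysics.QuantumFieldTheory.Balaban1983to89.PBond (F.P (Summit.QuantumFields.YangMills.Theorems.K0RecordFormatNames.recordK₀ F Mc k + n)) 0) (i i' : Fin 2) => ((Summit.QuantumFields.YangMills.Theorems.K0RecordFormatNames.recordBgField F θ k (Summit.QuantumFields.YangMills.Theorems.K0RecordFormatNames.recordK₀ F Mc k + n) B b : Literature.MathematicalPhysics.QuantumFieldTheory.Balaban1983to89.Node00.SU 2) : Matrix (Fin 2) (Fin 2) ℂ) i i') 0) → (∃ C₉' δ₉ : ℝ, 0 ≤ C₉' ∧ 0 < δ₉ ∧ ∀ (k n : ℕ) (ε₂₉ : ℝ), 0 < ε₂₉ → letI θ := Summit.QuantumFields.YangMills.Theorems.K0RecordFormatNames.thetaFill F a₀ ε₂₉; letI := θ.instVβ₁; letI := θ.instVβ₂; letI := θ.instιβ; ∀ (a : θ.ιβ) (μ : Fin (F.P (Summit.QuantumFields.YangMills.Theorems.K0RecordFormatNames.recordK₀ F Mc k + n)).d) (y : Literature.MathematicalPhysics.QuantumFieldTheory.Balaban1983to89.Site (F.P (Summit.QuantumFields.YangMills.Theorems.K0RecordFormatNames.recordK₀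 F Mc k + n)) (k + 1)), letI D := fderiv ℝ (fun B : Summit.QuantumFields.YangMills.Theorems.K0RecordFormatNames.recordW F a₀ ε₂₉ k (Summit.QuantumFields.YangMills.Theorems.K0RecordFormatNames.recordK₀ F Mc k + n) => fun (b : Literature.MathematicalPhysics.QuantumFieldTheory.Balaban1983to89.PBond (F.P (Summit.QuantumFields.YangMills.Theorems.K0RecordFormatNames.recordK₀ F Mc k + n)) 0) (i i' : Fin 2) => ((Summit.QuantumFields.YangMills.Theorems.K0RecordFormatNames.recordBgField F θ k (Summit.QuantumFields.YangMills.Theorems.K0RecordFormatNames.recordK₀ F Mc k + n) B b : Literature.MathematicalPhysics.QuantumFieldTheory.Balaban1983to89.Node00.SU 2) : Matrix (Fin 2) (Fin 2) ℂ) i i') 0 (Pi.single μ (Pi.single y (θ.bV a))); ∃ (Hr : Literature.MathematicalPhysics.QuantumFieldTheory.Balaban1983to89.PBond (F.P (Summit.QuantumFields.YangMills.Theorems.K0RecordFormatNames.recordK₀ F Mc k + n)) 0 → Fin 2 → Fin 2 → ℂ) (φ : Literature.MathematicalPhysics.QuantumFieldTheory.Balaban1983to89.Site (F.P (Summit.QuantumFields.YangMills.Theorems.K0RecordFormatNames.recordK₀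 F Mc k + n)) 0 → Fin 2 → Fin 2 → ℂ), (∀ b : Literature.MathematicalPhysics.QuantumFieldTheory.Balaban1983to89.PBond (F.P (Summit.QuantumFields.YangMills.Theorems.K0RecordFormatNames.recordK₀ F Mc k + n)) 0, D b = Hr b + (φ b.src - φ (b.src.shift b.dir))) ∧ (∃ μc : Literature.MathematicalPhysics.QuantumFieldTheory.Balaban1983to89.Site (F.P (Summit.QuantumFields.YangMills.Theorems.K0RecordFormatNames.recordK₀ F Mc k + n)) (k + 1) → Fin 2 → Fin 2 → ℂ, ∀ x : Literature.MathematicalPhysics.QuantumFieldTheory.Balaban1983to89.Site (F.P (Summit.QuantumFields.YangMills.Theorems.K0RecordFormatNames.recordK₀ F Mc k + n)) 0, letI dv := (fun x' : Literature.MathematicalPhysics.QuantumFieldTheory.Balaban1983to89.Site (F.P (Summit.QuantumFields.YangMills.Theorems.K0RecordFormatNames.recordK₀ F Mc k + n)) 0 => ∑ ν : Fin (F.P (Summit.QuantumFields.YangMills.Theorems.K0RecordFormatNames.recordK₀ F Mc k + n)).d, (Hr ⟨x', ν⟩ - Hr ⟨x'.unshift ν, ν⟩)); ∑ ν : Fin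 (F.P (Summit.QuantumFields.YangMills.Theorems.K0RecordFormatNames.recordK₀ F Mc k + n)).d, (dv (x.shift ν) - (2 : ℂ) • dv x + dv (x.unshift ν)) = μc (Summit.QuantumFields.YangMills.Theorems.K0RecordFormatNames.coarsenTo (k + 1) x)) ∧ ∀ b : Literature.MathematicalPhysics.QuantumFieldTheory.Balaban1983to89.PBond (F.P (Summit.QuantumFields.YangMills.Theorems.K0RecordFormatNames.recordK₀ F Mc k + n)) 0, ‖Hr b‖ ≤ C₉' * (F.P (Summit.QuantumFields.YangMills.Theorems.K0RecordFormatNames.recordK₀ F Mc k + n)).eta (k + 1) * Real.exp (-(δ₉ * (Literature.MathematicalPhysics.QuantumFieldTheory.Balaban1983to89.Site.tdist (Summit.QuantumFields.YangMills.Theorems.K0RecordFormatNames.coarsenTo (k + 1) b.src) y : ℝ))) ∧ (∀ ν : Fin (F.P (Summit.QuantumFields.YangMills.Theorems.K0RecordFormatNames.recordK₀ F Mc k + n)).d, ‖Hr (⟨b.src.shift ν, b.dir⟩ : Literature.MathematicalPhysics.QuantumFieldTheory.Balaban1983to89.PBond (F.P (Summit.QuantumFields.YangMills.Theorems.K0RecordFormatNames.recordK₀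 F Mc k + n)) 0) - Hr b‖ ≤ C₉' * (F.P (Summit.QuantumFields.YangMills.Theorems.K0RecordFormatNames.recordK₀ F Mc k + n)).eta (k + 1) ^ 2 * Real.exp (-(δ₉ * (Literature.MathematicalPhysics.QuantumFieldTheory.Balaban1983to89.Site.tdist (Summit.QuantumFields.YangMills.Theorems.K0RecordFormatNames.coarsenTo (k + 1) b.src) y : ℝ)))) ∧ ‖∑ ν : Fin (F.P (Summit.QuantumFields.YangMills.Theorems.K0RecordFormatNames.recordK₀ F Mc k + n)).d, (Hr (⟨b.src.shift ν, b.dir⟩ : Literature.MathematicalPhysics.QuantumFieldTheory.Balaban1983to89.PBond (F.P (Summit.QuantumFields.YangMills.Theorems.K0RecordFormatNames.recordK₀ F Mc k + n)) 0) - (2 : ℂ) • Hr b + Hr (⟨b.src.unshift ν, b.dir⟩ : Literature.MathematicalPhysics.QuantumFieldTheory.Balaban1983to89.PBond (F.P (Summit.QuantumFields.YangMills.Theorems.K0RecordFormatNames.recordK₀ F Mc k + n)) 0))‖ ≤ C₉' * (F.P (Summit.QuantumFields.YangMills.Theorems.K0RecordFormatNames.recordK₀ F Mc k + n)).eta (k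 + 1) ^ 3 * Real.exp (-(δ₉ * (Literature.MathematicalPhysics.QuantumFieldTheory.Balaban1983to89.Site.tdist (Summit.QuantumFields.YangMills.Theorems.K0RecordFormatNames.coarsenTo (k + 1) b.src) y : ℝ))) ∧ ‖∑ ν : Fin (F.P (Summit.QuantumFields.YangMills.Theorems.K0RecordFormatNames.recordK₀ F Mc k + n)).d, ((Hr (⟨b.src, b.dir⟩ : Literature.MathematicalPhysics.QuantumFieldTheory.Balaban1983to89.PBond (F.P (Summit.QuantumFields.YangMills.Theorems.K0RecordFormatNames.recordK₀ F Mc k + n)) 0) + Hr (⟨(b.src).shift b.dir, ν⟩ : Literature.MathematicalPhysics.QuantumFieldTheory.Balaban1983to89.PBond (F.P (Summit.QuantumFields.YangMills.Theorems.K0RecordFormatNames.recordK₀ F Mc k + n)) 0) - Hr (⟨(b.src).shift ν, b.dir⟩ : Literature.MathematicalPhysics.QuantumFieldTheory.Balaban1983to89.PBond (F.P (Summit.QuantumFields.YangMills.Theorems.K0RecordFormatNames.recordK₀ F Mc k + n)) 0) - Hr (⟨b.src, ν⟩ : Literature.MathematicalPhysics.QuantumFieldTheory.Balaban1983to89.PBond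 (F.P (Summit.QuantumFields.YangMills.Theorems.K0RecordFormatNames.recordK₀ F Mc k + n)) 0)) - (Hr (⟨b.src.unshift ν, b.dir⟩ : Literature.MathematicalPhysics.QuantumFieldTheory.Balaban1983to89.PBond (F.P (Summit.QuantumFields.YangMills.Theorems.K0RecordFormatNames.recordK₀ F Mc k + n)) 0) + Hr (⟨(b.src.unshift ν).shift b.dir, ν⟩ : Literature.MathematicalPhysics.QuantumFieldTheory.Balaban1983to89.PBond (F.P (Summit.QuantumFields.YangMills.Theorems.K0RecordFormatNames.recordK₀ F Mc k + n)) 0) - Hr (⟨(b.src.unshift ν).shift ν, b.dir⟩ : Literature.MathematicalPhysics.QuantumFieldTheory.Balaban1983to89.PBond (F.P (Summit.QuantumFields.YangMills.Theorems.K0RecordFormatNames.recordK₀ F Mc k + n)) 0) - Hr (⟨b.src.unshift ν, ν⟩ : Literature.MathematicalPhysics.QuantumFieldTheory.Balaban1983to89.PBond (F.P (Summit.QuantumFields.YangMills.Theorems.K0RecordFormatNames.recordK₀ F Mc k + n)) 0)))‖ ≤ C₉' * (F.P (Summit.QuantumFields.YangMills.Theorems.K0RecordFormatNames.recordK₀ F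 Mc k + n)).eta (k + 1) ^ 3 * Real.exp (-(δ₉ * (Literature.MathematicalPhysics.QuantumFieldTheory.Balaban1983to89.Site.tdist (Summit.QuantumFields.YangMills.Theorems.K0RecordFormatNames.coarsenTo (k + 1) b.src) y : ℝ)))) → ∀ ε₂₉ : ℝ, 0 < ε₂₉ → ∃ εA : ℝ, 0 < εA ∧ ∀ ε₀ : ℝ, 0 < ε₀ → ε₀ ≤ εA → ∀ (k n : ℕ) (B : Summit.QuantumFields.YangMills.Theorems.K0RecordFormatNames.recordW F a₀ ε₂₉ k (Summit.QuantumFields.YangMills.Theorems.K0RecordFormatNames.recordK₀ F Mc k + n)), Summit.QuantumFields.YangMills.Theorems.K0RecordFormatNames.InRegClass F Mc k ε₀ a₀ ε₂₉ n B →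
      ContDiffAt ℝ 2 (recordAUk F k (recordK₀ F Mc k + n) a₀ (portVkAx F a₀ ε₂₉ k (recordK₀ F Mc k + n) B)) 0

/-! ## §1  An elementary Schur bound for a real quadratic form -/
/-- **Schur for quadratic forms**: if every row sum and every column sum of `|T|` is `≤ M` then `⟨w, Tw⟩ ≤ M|w|²` (AM–GM entry by entry). [folklore] -/
theorem dotProduct_mulVec_le_of_abs_row_col {ι : Type*} [Fintype ι] (T : Matrix ι ι ℝ) {M : ℝ}
    (hrow : ∀ i, ∑ j, |T i j| ≤ M) (hcol : ∀ j, ∑ i, |T i j| ≤ M) (w : ι → ℝ) :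
    w ⬝ᵥ (T *ᵥ w) ≤ M * (w ⬝ᵥ w) := by
  classical
  have hexp : w ⬝ᵥ (T *ᵥ w) = ∑ i, ∑ j, w i * (T i j * w j) := by
    simp only [dotProduct, mulVec, Finset.mul_sum]
  have hww : w ⬝ᵥ w = ∑ i, w i ^ 2 := by
    simp only [dotProduct, sq]
  have key : ∀ i j, w i * (T i j * w j) ≤ |T i j| * w i ^ 2 / 2 + |T i j| * w j ^ 2 / 2 := by
    intro i j
    have h1 : w i * (T i j * w j) ≤ |T i j| * (|w i| * |w j|) := by
      calc w i * (T i j * w j) = T i j * (w i * w j) := by ring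
        _ ≤ |T i j * (w i * w j)| := le_abs_self _
        _ = |T i j| * (|w i| * |w j|) := by rw [abs_mul, abs_mul]
    have h2 : 2 * (|w i| * |w j|) ≤ w i ^ 2 + w j ^ 2 := by
      nlinarith [sq_nonneg (|w i| - |w j|), sq_abs (w i), sq_abs (w j)]
    nlinarith [abs_nonneg (T i j)]
  have A : ∑ i, ∑ j, |T i j| * w i ^ 2 / 2 ≤ M * (∑ i, w i ^ 2) / 2 := by
    have h : ∀ i, ∑ j, |T i j| * w i ^ 2 / 2 = (∑ j, |T i j|) * (w i ^ 2 / 2) := fun i => by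
      rw [Finset.sum_mul]; exact Finset.sum_congr rfl fun j _ => by ring
    calc ∑ i, ∑ j, |T i j| * w i ^ 2 / 2 = ∑ i, (∑ j, |T i j|) * (w i ^ 2 / 2) := Finset.sum_congr rfl fun i _ => h i
      _ ≤ ∑ i, M * (w i ^ 2 / 2) := Finset.sum_le_sum fun i _ => mul_le_mul_of_nonneg_right (hrow i) (by positivity)
      _ = M * (∑ i, w i ^ 2) / 2 := by rw [← Finset.mul_sum, ← Finset.sum_div]; ring
  have B : ∑ i, ∑ j, |T i j| * w j ^ 2 / 2 ≤ M * (∑ j, w j ^ 2) / 2 := by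
    rw [Finset.sum_comm]
    have h : ∀ j, ∑ i, |T i j| * w j ^ 2 / 2 = (∑ i, |T i j|) * (w j ^ 2 / 2) := fun j => by
      rw [Finset.sum_mul]; exact Finset.sum_congr rfl fun i _ => by ring
    calc ∑ j, ∑ i, |T i j| * w j ^ 2 / 2 = ∑ j, (∑ i, |T i j|) * (w j ^ 2 / 2) := Finset.sum_congr rfl fun j _ => h j
      _ ≤ ∑ j, M * (w j ^ 2 / 2) := Finset.sum_le_sum fun j _ => mul_le_mul_of_nonneg_right (hcol j) (by positivity)
      _ = M * (∑ j, w j ^ 2) / 2 := by rw [← Finset.mul_sum, ← Finset.sum_div]; ring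
  have C : ∑ i, ∑ j, w i * (T i j * w j) ≤ ∑ i, ∑ j, (|T i j| * w i ^ 2 / 2 + |T i j| * w j ^ 2 / 2) :=
    Finset.sum_le_sum fun i _ => Finset.sum_le_sum fun j _ => key i j
  have D : ∑ i, ∑ j, (|T i j| * w i ^ 2 / 2 + |T i j| * w j ^ 2 / 2) =
      (∑ i, ∑ j, |T i j| * w i ^ 2 / 2) + ∑ i, ∑ j, |T i j| * w j ^ 2 / 2 := by
    rw [← Finset.sum_add_distrib]
    exact Finset.sum_congr rfl fun i _ => Finset.sum_add_distrib
  rw [hexp, hww]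
  linarith

/-- A sum of non-negative reals over the non-`b₀` sub-index is at most the full sum. [folklore] -/
theorem sum_nonB0_le_sum {F : T4Family} (k K : ℕ) (f : FluctIdx F k K → ℝ) (hf : ∀ l, 0 ≤ f l) :
    ∑ l : NonB0Idx F k K, f l.1 ≤ ∑ l, f l := by
  classical
  rw [← Finset.sum_subtype (univ.filter fun i : FluctIdx F k K => i.1 ∉ Set.range (recordB0 F k K)) (by simp) f]
  exact Finset.sum_le_univ_sum_of_nonneg hf

/-! ## §2  The carrier at the UNCUT pair of a point whose cut pairs lie in the record spaces: agreement with the `⊤`-cut, Schur rows and columns -/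

section Carrier
variable (F : T4Family)
variable {Mc : ℕ} {k : ℕ} {a₀ δ₀ c₀ γ₀ γ₁ α₀ α₁ ε₂₉ : ℝ}
  {TC : (n : ℕ) → Sect2.CPair (F.P (recordK₀ F Mc k + n)) (MatA 2) → FluctIdx F k (recordK₀ F Mc k + n) → FluctIdx F k (recordK₀ F Mc k + n) → ℂ}
  {TY : (n : ℕ) → (recordDomSys F Mc k (recordK₀ F Mc k + n)).Dom → Sect2.CPair (F.P (recordK₀ F Mc k + n)) (MatA 2) →
      FluctIdx F k (recordK₀ F Mc k + n) → FluctIdx F k (recordK₀ F Mc k + n) → ℂ}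
  {TZY : Finset (Fin 4 → ℤ) → IntBondCfg → ((Fin 4 → ℤ) × Fin 4) × Fin 3 → ((Fin 4 → ℤ) × Fin 4) × Fin 3 → ℂ}
  {AdM : (n : ℕ) → (Site (F.P (recordK₀ F Mc k + n)) 0 → (MatA 2)ˣ) → Matrix (FluctIdx F k (recordK₀ F Mc k + n)) (FluctIdx F k (recordK₀ F Mc k + n)) ℂ}
  {AdZ : ((Fin 4 → ℤ) → (MatA 2)ˣ) → (Fin 4 → ℤ) × Fin 4 → Matrix (Fin 3) (Fin 3) ℂ}

/-- **Every fine site lies in the site set of the whole-torus domain `⊤ = g3cFull`** (N18's ✓`mem_domSites_univ`, `0 < Mc` from `McGuard`). [cite: Balaban1987RG1, p.257 (bookkeeping)] -/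
theorem mem_domSites_g3cFull (hMc : McGuard F Mc) (n : ℕ) (y : Site (F.P (recordK₀ F Mc k + n)) 0) :
    y ∈ Sect2.domSites (F.P (recordK₀ F Mc k + n)) Mc (k + 1) (g3cFull F Mc k (recordK₀ F Mc k + n)) :=
  YMDAG.N18.TransportOfRecord.mem_domSites_univ (PortHRecordRowG.mc_pos hMc) (k + 1) y

/-- **The uncut (1.9) pair of `U_{k+1}(W_B)` agrees with its `⊤`-cut on the sites of EVERY domain `Y`** (they agree on `domSites ⊤` = all sites). [cite: Balaban1987RG1, (1.7)–(1.9) p.261 (bookkeeping)] -/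
theorem agreeOnSet_recordPairJ_pairCut_g3cFull (hMc : McGuard F Mc) (n : ℕ) (B : recordW F a₀ ε₂₉ k (recordK₀ F Mc k + n))
    (Y : (recordDomSys F Mc k (recordK₀ F Mc k + n)).Dom) :
    letI θ := thetaFill F a₀ ε₂₉; letI := θ.instVβ₁; letI := θ.instVβ₂; letI := θ.instιβ
    Sect2.agreeOnSet (Sect2.domSites (F.P (recordK₀ F Mc k + n)) Mc (k + 1) Y)
      (recordPairJ F θ k (recordK₀ F Mc k + n) B) (pairCutTorusAt F a₀ ε₂₉ Mc k (recordK₀ F Mc k + n) (g3cFull F Mc k (recordK₀ F Mc k + n)) B) :=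
  fun b _ _ => agreeOnSet_pairCutTorusAt a₀ ε₂₉ Mc k (recordK₀ F Mc k + n) (g3cFull F Mc k (recordK₀ F Mc k + n)) B b
    (mem_domSites_g3cFull F hMc n _) (mem_domSites_g3cFull F hMc n _)

/-- **The total carrier at the uncut pair IS the total carrier at the `⊤`-cut pair** ((P4).1 `TC = Σ_Y TY` + (P4).3 locality, piece by piece). [cite: Balaban1987RG1, (1.7) p.261] -/
theorem TC_recordPairJ_eq_pairCut_g3cFull (hMc : McGuard F Mc) (hP : P0CarrierClauses F a₀ δ₀ c₀ γ₀ γ₁ Mc α₀ α₁ ε₂₉ k TC TY TZY AdM AdZ) (n : ℕ)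
    (B : recordW F a₀ ε₂₉ k (recordK₀ F Mc k + n)) (i j : FluctIdx F k (recordK₀ F Mc k + n)) :
    letI θ := thetaFill F a₀ ε₂₉; letI := θ.instVβ₁; letI := θ.instVβ₂; letI := θ.instιβ
    TC n (recordPairJ F θ k (recordK₀ F Mc k + n) B) i j = TC n (pairCutTorusAt F a₀ ε₂₉ Mc k (recordK₀ F Mc k + n) (g3cFull F Mc k (recordK₀ F Mc k + n)) B) i j := by
  obtain ⟨-, -, -, -, -, -, -, hP4sum, -, hP4agree, -, -, -⟩ := hP
  rw [hP4sum, hP4sum]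
  exact Finset.sum_congr rfl fun Y _ => by rw [hP4agree n Y _ _ (agreeOnSet_recordPairJ_pairCut_g3cFull F hMc n B Y)]

/-- ★ **SCHUR ROWS OF THE TOTAL CARRIER AT THE UNCUT PAIR**: if every cut pair of `B` lies in its record space (`CutsInUc`) and `δ₀ ≥ κ₀(64, 8)`, then every row of `TC(recordPairJ B)` has
`Σ_j ‖·‖ ≤ c₀·K₀(64, 8)` — (P4) support in cube form, locality (rows at the cut pair of each `Y`), Schur decay, and the anchored tree-graph sum (1.26) (✓`treeLeaf_recordCc`).
[cite: Balaban1987RG1, (1.7) p.261, (1.18) p.263, (0.26) p.257; Balaban1988RG2Cluster, (1.26) p.8] -/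
theorem sum_norm_TC_row_le (hMc : McGuard F Mc) (hP : P0CarrierClauses F a₀ δ₀ c₀ γ₀ γ₁ Mc α₀ α₁ ε₂₉ k TC TY TZY AdM AdZ) (hc₀ : 0 ≤ c₀)
    (hδ₀ : kappa₀ (4 * 2 ^ 4) (2 * 4) ≤ δ₀) (n : ℕ) {B : recordW F a₀ ε₂₉ k (recordK₀ F Mc k + n)} (hcut : CutsInUc F Mc k α₀ α₁ a₀ ε₂₉ n B)
    (i : FluctIdx F k (recordK₀ F Mc k + n)) :
    letI θ := thetaFill F a₀ ε₂₉; letI := θ.instVβ₁; letI := θ.instVβ₂; letI := θ.instιβ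
    ∑ j, ‖TC n (recordPairJ F θ k (recordK₀ F Mc k + n) B) i j‖ ≤ c₀ * K₀ (4 * 2 ^ 4) (2 * 4) := by
  classical
  letI θ := thetaFill F a₀ ε₂₉; letI := θ.instVβ₁; letI := θ.instVβ₂; letI := θ.instιβ
  obtain ⟨-, -, -, -, -, -, -, hP4sum, hP4supp, hP4agree, hP4an, -, -⟩ := hP
  have hK : recordK₀ F Mc k ≤ recordK₀ F Mc k + n := Nat.le_add_right _ _
  set φ : Sect2.CPair (F.P (recordK₀ F Mc k + n)) (MatA 2) := recordPairJ F θ k (recordK₀ F Mc k + n) B with hφ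
  set c := cubeOfSite F Mc k (recordK₀ F Mc k + n) (blockOf i.1.src) with hc
  -- TC = Σ_Y TY, triangle inequality, swap
  have h1 : ∑ j, ‖TC n φ i j‖ ≤ ∑ Y, ∑ j, ‖TY n Y φ i j‖ := by
    calc ∑ j, ‖TC n φ i j‖ ≤ ∑ j, ∑ Y, ‖TY n Y φ i j‖ := Finset.sum_le_sum fun j _ => by rw [hP4sum n φ i j]; exact norm_sum_le _ _
      _ = ∑ Y, ∑ j, ‖TY n Y φ i j‖ := Finset.sum_comm
  -- per domain: zero unless `□(i) ∈ Y`, else the Schur row at the cut pair of `Y`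
  have h2 : ∀ Y : (recordDomSys F Mc k (recordK₀ F Mc k + n)).Dom, ∑ j, ‖TY n Y φ i j‖ ≤
      if c ∈ (Y.1 : Finset _) then c₀ * Real.exp (-(δ₀ * (recordDomSys F Mc k (recordK₀ F Mc k + n)).dj Y)) else 0 := by
    intro Y
    by_cases hcY : c ∈ (Y.1 : Finset _)
    · rw [if_pos hcY]
      have hag : Sect2.agreeOnSet (Sect2.domSites (F.P (recordK₀ F Mc k + n)) Mc (k + 1) Y) φ (pairCutTorusAt F a₀ ε₂₉ Mc k (recordK₀ F Mc k + n) Y B) :=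
        agreeOnSet_pairCutTorusAt a₀ ε₂₉ Mc k (recordK₀ F Mc k + n) Y B
      rw [hP4agree n Y φ _ hag]
      exact (hP4an n Y _ (hcut Y)).2.1 i
    · rw [if_neg hcY]
      have hz : ∀ j, TY n Y φ i j = 0 := fun j =>
        hP4supp n Y φ i j (Or.inl fun hm => hcY (cubeOfSite_blockOf_mem_of_embIter_mem_domSites hMc hK Y _ hm))
      simp [hz]
  -- the anchored animal sum (1.26)
  have hset : ∀ Y : (recordDomSys F Mc k (recordK₀ F Mc k + n)).Dom, Y ∈ (recordCc F Mc k (recordK₀ F Mc k + n)).above c ↔ c ∈ (Y.1 : Finset _) := by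
    intro Y
    show Y ∈ (recordCubeSys F Mc k (recordK₀ F Mc k + n)).above c ↔ _
    rw [B12TreeDecay.CubeSystem.mem_above]
    rfl
  have hleaf : ∑ Y ∈ (recordCc F Mc k (recordK₀ F Mc k + n)).above c, Real.exp (-δ₀ * (recordDomSys F Mc k (recordK₀ F Mc k + n)).dj Y) ≤ K₀ (4 * 2 ^ 4) (2 * 4) :=
    treeLeaf_recordCc (F := F) hδ₀ Mc k (recordK₀ F Mc k + n) c
  have h3 : ∑ Y : (recordDomSys F Mc k (recordK₀ F Mc k + n)).Dom, (if c ∈ (Y.1 : Finset _) then c₀ * Real.exp (-(δ₀ * (recordDomSys F Mc k (recordK₀ F Mc k + n)).dj Y)) else 0) ≤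
      c₀ * K₀ (4 * 2 ^ 4) (2 * 4) := by
    have hsum : ∑ Y : (recordDomSys F Mc k (recordK₀ F Mc k + n)).Dom, (if c ∈ (Y.1 : Finset _) then c₀ * Real.exp (-(δ₀ * (recordDomSys F Mc k (recordK₀ F Mc k + n)).dj Y)) else 0) =
        ∑ Y ∈ (recordCc F Mc k (recordK₀ F Mc k + n)).above c, c₀ * Real.exp (-δ₀ * (recordDomSys F Mc k (recordK₀ F Mc k + n)).dj Y) := by
      rw [← Finset.sum_filter]
      refine Finset.sum_congr ?_ fun Y _ => by rw [neg_mul]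
      ext Y
      rw [Finset.mem_filter, hset]
      simp
    rw [hsum, ← Finset.mul_sum]
    exact mul_le_mul_of_nonneg_left hleaf hc₀
  exact h1.trans ((Finset.sum_le_sum fun Y _ => h2 Y).trans h3)

/-- ★ **SCHUR COLUMNS OF THE TOTAL CARRIER AT THE UNCUT PAIR** (same, by the column half of (P4)'s Schur decay). [cite: Balaban1987RG1, (1.7) p.261, (1.18) p.263; Balaban1988RG2Cluster, (1.26) p.8] -/
theorem sum_norm_TC_col_le (hMc : McGuard F Mc) (hP : P0CarrierClauses F a₀ δ₀ c₀ γ₀ γ₁ Mc α₀ α₁ ε₂₉ k TC TY TZY AdM AdZ) (hc₀ : 0 ≤ c₀)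
    (hδ₀ : kappa₀ (4 * 2 ^ 4) (2 * 4) ≤ δ₀) (n : ℕ) {B : recordW F a₀ ε₂₉ k (recordK₀ F Mc k + n)} (hcut : CutsInUc F Mc k α₀ α₁ a₀ ε₂₉ n B)
    (j : FluctIdx F k (recordK₀ F Mc k + n)) :
    letI θ := thetaFill F a₀ ε₂₉; letI := θ.instVβ₁; letI := θ.instVβ₂; letI := θ.instιβ
    ∑ i, ‖TC n (recordPairJ F θ k (recordK₀ F Mc k + n) B) i j‖ ≤ c₀ * K₀ (4 * 2 ^ 4) (2 * 4) := by
  classical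
  letI θ := thetaFill F a₀ ε₂₉; letI := θ.instVβ₁; letI := θ.instVβ₂; letI := θ.instιβ
  obtain ⟨-, -, -, -, -, -, -, hP4sum, hP4supp, hP4agree, hP4an, -, -⟩ := hP
  have hK : recordK₀ F Mc k ≤ recordK₀ F Mc k + n := Nat.le_add_right _ _
  set φ : Sect2.CPair (F.P (recordK₀ F Mc k + n)) (MatA 2) := recordPairJ F θ k (recordK₀ F Mc k + n) B with hφ
  set c := cubeOfSite F Mc k (recordK₀ F Mc k + n) (blockOf j.1.src) with hc
  have h1 : ∑ i, ‖TC n φ i j‖ ≤ ∑ Y, ∑ i, ‖TY n Y φ i j‖ := by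
    calc ∑ i, ‖TC n φ i j‖ ≤ ∑ i, ∑ Y, ‖TY n Y φ i j‖ := Finset.sum_le_sum fun i _ => by rw [hP4sum n φ i j]; exact norm_sum_le _ _
      _ = ∑ Y, ∑ i, ‖TY n Y φ i j‖ := Finset.sum_comm
  have h2 : ∀ Y : (recordDomSys F Mc k (recordK₀ F Mc k + n)).Dom, ∑ i, ‖TY n Y φ i j‖ ≤
      if c ∈ (Y.1 : Finset _) then c₀ * Real.exp (-(δ₀ * (recordDomSys F Mc k (recordK₀ F Mc k + n)).dj Y)) else 0 := by
    intro Y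
    by_cases hcY : c ∈ (Y.1 : Finset _)
    · rw [if_pos hcY]
      have hag : Sect2.agreeOnSet (Sect2.domSites (F.P (recordK₀ F Mc k + n)) Mc (k + 1) Y) φ (pairCutTorusAt F a₀ ε₂₉ Mc k (recordK₀ F Mc k + n) Y B) :=
        agreeOnSet_pairCutTorusAt a₀ ε₂₉ Mc k (recordK₀ F Mc k + n) Y B
      rw [hP4agree n Y φ _ hag]
      exact (hP4an n Y _ (hcut Y)).2.2 j
    · rw [if_neg hcY]
      have hz : ∀ i, TY n Y φ i j = 0 := fun i =>
        hP4supp n Y φ i j (Or.inr fun hm => hcY (cubeOfSite_blockOf_mem_of_embIter_mem_domSites hMc hK Y _ hm))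
      simp [hz]
  have hset : ∀ Y : (recordDomSys F Mc k (recordK₀ F Mc k + n)).Dom, Y ∈ (recordCc F Mc k (recordK₀ F Mc k + n)).above c ↔ c ∈ (Y.1 : Finset _) := by
    intro Y
    show Y ∈ (recordCubeSys F Mc k (recordK₀ F Mc k + n)).above c ↔ _
    rw [B12TreeDecay.CubeSystem.mem_above]
    rfl
  have hleaf : ∑ Y ∈ (recordCc F Mc k (recordK₀ F Mc k + n)).above c, Real.exp (-δ₀ * (recordDomSys F Mc k (recordK₀ F Mc k + n)).dj Y) ≤ K₀ (4 * 2 ^ 4) (2 * 4) :=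
    treeLeaf_recordCc (F := F) hδ₀ Mc k (recordK₀ F Mc k + n) c
  have h3 : ∑ Y : (recordDomSys F Mc k (recordK₀ F Mc k + n)).Dom, (if c ∈ (Y.1 : Finset _) then c₀ * Real.exp (-(δ₀ * (recordDomSys F Mc k (recordK₀ F Mc k + n)).dj Y)) else 0) ≤
      c₀ * K₀ (4 * 2 ^ 4) (2 * 4) := by
    have hsum : ∑ Y : (recordDomSys F Mc k (recordK₀ F Mc k + n)).Dom, (if c ∈ (Y.1 : Finset _) then c₀ * Real.exp (-(δ₀ * (recordDomSys F Mc k (recordK₀ F Mc k + n)).dj Y)) else 0) =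
        ∑ Y ∈ (recordCc F Mc k (recordK₀ F Mc k + n)).above c, c₀ * Real.exp (-δ₀ * (recordDomSys F Mc k (recordK₀ F Mc k + n)).dj Y) := by
      rw [← Finset.sum_filter]
      refine Finset.sum_congr ?_ fun Y _ => by rw [neg_mul]
      ext Y
      rw [Finset.mem_filter, hset]
      simp
    rw [hsum, ← Finset.mul_sum]
    exact mul_le_mul_of_nonneg_left hleaf hc₀
  exact h1.trans ((Finset.sum_le_sum fun Y _ => h2 Y).trans h3)

/-! ## §3  (M7-pos) and (M7-up) at one point -/
/-- ★★ **(M7-pos) AT ONE POINT FROM THE CARRIER CLAUSES**: if every cut pair of `B` lies in its record space and the carrier at the uncut pair IS a real matrix `T` on `NonB0Idx` (the (P2)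
identity at `B`), then `γ₀|w|² ≤ ⟨w, Tw⟩` for every real `w` — (P5ᶜ) at `X = ⊤` (support clause vacuous, `Σ_{Y ⊆ ⊤} TY = TC`, `⊤`-cut = uncut on every piece) read at the real vector `w`.
[cite: Balaban1987RG1, (2.11)–(2.12) pp.267–268 («positive definite operator C*Δ^{(k)}C»); Balaban1985BackgroundPropagators, (3.156)–(3.158) p.428] -/
theorem posLower_recordPreckLoc_of_P0C (hMc : McGuard F Mc) (hP : P0CarrierClauses F a₀ δ₀ c₀ γ₀ γ₁ Mc α₀ α₁ ε₂₉ k TC TY TZY AdM AdZ) (n : ℕ)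
    {B : recordW F a₀ ε₂₉ k (recordK₀ F Mc k + n)} (hcut : CutsInUc F Mc k α₀ α₁ a₀ ε₂₉ n B)
    (T : Matrix (NonB0Idx F k (recordK₀ F Mc k + n)) (NonB0Idx F k (recordK₀ F Mc k + n)) ℝ)
    (hP2B : letI θ := thetaFill F a₀ ε₂₉; letI := θ.instVβ₁; letI := θ.instVβ₂; letI := θ.instιβ
      ∀ i j : NonB0Idx F k (recordK₀ F Mc k + n), TC n (recordPairJ F θ k (recordK₀ F Mc k + n) B) i.1 j.1 = ((T i j : ℝ) : ℂ))
    (w : NonB0Idx F k (recordK₀ F Mc k + n) → ℝ) : γ₀ * (w ⬝ᵥ w) ≤ w ⬝ᵥ (T *ᵥ w) := by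
  classical
  letI θ := thetaFill F a₀ ε₂₉; letI := θ.instVβ₁; letI := θ.instVβ₂; letI := θ.instιβ
  have hTC := TC_recordPairJ_eq_pairCut_g3cFull F hMc hP n B
  obtain ⟨-, -, -, -, -, -, -, hP4sum, -, -, -, -, hP5c⟩ := hP
  have h := hP5c n (g3cFull F Mc k (recordK₀ F Mc k + n)) (pairCutTorusAt F a₀ ε₂₉ Mc k (recordK₀ F Mc k + n) (g3cFull F Mc k (recordK₀ F Mc k + n)) B) (hcut _) (fun i => ((w i : ℝ) : ℂ))
    (fun i hi => absurd (mem_domSites_g3cFull F hMc n _) hi)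
  have hfilter : (univ.filter fun Y : (recordDomSys F Mc k (recordK₀ F Mc k + n)).Dom => (Y.1 : Finset _) ⊆ (g3cFull F Mc k (recordK₀ F Mc k + n)).1) = univ :=
    Finset.filter_true_of_mem fun Y _ => fun c _ => mem_g3cFull F Mc k (recordK₀ F Mc k + n) c
  have hsumTC : ∀ i j : NonB0Idx F k (recordK₀ F Mc k + n),
      (∑ Y ∈ univ.filter (fun Y : (recordDomSys F Mc k (recordK₀ F Mc k + n)).Dom => (Y.1 : Finset _) ⊆ (g3cFull F Mc k (recordK₀ F Mc k + n)).1),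
        TY n Y (pairCutTorusAt F a₀ ε₂₉ Mc k (recordK₀ F Mc k + n) (g3cFull F Mc k (recordK₀ F Mc k + n)) B) i.1 j.1) = ((T i j : ℝ) : ℂ) := by
    intro i j
    rw [hfilter, ← hP4sum, ← hTC, hP2B]
  simp_rw [hsumTC] at h
  have hstar : ∀ i : NonB0Idx F k (recordK₀ F Mc k + n), star ((w i : ℝ) : ℂ) = ((w i : ℝ) : ℂ) := fun i => by
    rw [Complex.star_def, Complex.conj_ofReal]
  simp_rw [hstar] at h
  have hl : ∑ i : NonB0Idx F k (recordK₀ F Mc k + n), ‖((w i : ℝ) : ℂ)‖ ^ 2 = w ⬝ᵥ w := by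
    refine Finset.sum_congr rfl fun i _ => ?_
    rw [Complex.norm_real, Real.norm_eq_abs, sq_abs, sq]
  have hcast : (∑ i : NonB0Idx F k (recordK₀ F Mc k + n), ∑ j, ((w i : ℝ) : ℂ) * ((T i j : ℝ) : ℂ) * ((w j : ℝ) : ℂ)) =
      ((∑ i : NonB0Idx F k (recordK₀ F Mc k + n), ∑ j, w i * T i j * w j : ℝ) : ℂ) := by
    push_cast
    rfl
  have hr : ∑ i : NonB0Idx F k (recordK₀ F Mc k + n), ∑ j, w i * T i j * w j = w ⬝ᵥ (T *ᵥ w) := by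
    simp only [dotProduct, mulVec, Finset.mul_sum]
    exact Finset.sum_congr rfl fun i _ => Finset.sum_congr rfl fun j _ => by ring
  rw [hl, hcast, Complex.ofReal_re, hr] at h
  exact h

/-- ★★ **(M7-up) AT ONE POINT FROM THE CARRIER CLAUSES**: under the same hypotheses and `δ₀ ≥ κ₀(64, 8)`, `⟨w, Tw⟩ ≤ c₀K₀(64, 8)|w|²` (§1 with §2's Schur rows∕columns; `|T_{ij}| = |Re TC_{ij}| ≤
‖TC_{ij}‖`). [cite: Balaban1987RG1, (1.18) p.263, (2.11) p.267; Balaban1988RG2Cluster, (1.26) p.8] -/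
theorem upper_recordPreckLoc_of_P0C (hMc : McGuard F Mc) (hP : P0CarrierClauses F a₀ δ₀ c₀ γ₀ γ₁ Mc α₀ α₁ ε₂₉ k TC TY TZY AdM AdZ) (hc₀ : 0 ≤ c₀)
    (hδ₀ : kappa₀ (4 * 2 ^ 4) (2 * 4) ≤ δ₀) (n : ℕ) {B : recordW F a₀ ε₂₉ k (recordK₀ F Mc k + n)} (hcut : CutsInUc F Mc k α₀ α₁ a₀ ε₂₉ n B)
    (T : Matrix (NonB0Idx F k (recordK₀ F Mc k + n)) (NonB0Idx F k (recordK₀ F Mc k + n)) ℝ)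
    (hP2B : letI θ := thetaFill F a₀ ε₂₉; letI := θ.instVβ₁; letI := θ.instVβ₂; letI := θ.instιβ
      ∀ i j : NonB0Idx F k (recordK₀ F Mc k + n), TC n (recordPairJ F θ k (recordK₀ F Mc k + n) B) i.1 j.1 = ((T i j : ℝ) : ℂ))
    (w : NonB0Idx F k (recordK₀ F Mc k + n) → ℝ) : w ⬝ᵥ (T *ᵥ w) ≤ (c₀ * K₀ (4 * 2 ^ 4) (2 * 4)) * (w ⬝ᵥ w) := by
  classical
  letI θ := thetaFill F a₀ ε₂₉; letI := θ.instVβ₁; letI := θ.instVβ₂; letI := θ.instιβ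
  have habs : ∀ i j : NonB0Idx F k (recordK₀ F Mc k + n), |T i j| ≤ ‖TC n (recordPairJ F θ k (recordK₀ F Mc k + n) B) i.1 j.1‖ := by
    intro i j
    have h : T i j = (TC n (recordPairJ F θ k (recordK₀ F Mc k + n) B) i.1 j.1).re := by rw [hP2B i j, Complex.ofReal_re]
    rw [h]
    exact Complex.abs_re_le_norm _
  refine dotProduct_mulVec_le_of_abs_row_col T (fun i => ?_) (fun j => ?_) w
  · calc ∑ j : NonB0Idx F k (recordK₀ F Mc k + n), |T i j| ≤ ∑ j : NonB0Idx F k (recordK₀ F Mc k + n), ‖TC n (recordPairJ F θ k (recordK₀ F Mc k + n) B) i.1 j.1‖ := Finset.sum_le_sum fun j _ => habs i j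
      _ ≤ ∑ j, ‖TC n (recordPairJ F θ k (recordK₀ F Mc k + n) B) i.1 j‖ := sum_nonB0_le_sum k (recordK₀ F Mc k + n) (fun j => ‖TC n (recordPairJ F θ k (recordK₀ F Mc k + n) B) i.1 j‖) fun _ => norm_nonneg _
      _ ≤ c₀ * K₀ (4 * 2 ^ 4) (2 * 4) := sum_norm_TC_row_le F hMc hP hc₀ hδ₀ n hcut i.1
  · calc ∑ i : NonB0Idx F k (recordK₀ F Mc k + n), |T i j| ≤ ∑ i : NonB0Idx F k (recordK₀ F Mc k + n), ‖TC n (recordPairJ F θ k (recordK₀ F Mc k + n) B) i.1 j.1‖ := Finset.sum_le_sum fun i _ => habs i j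
      _ ≤ ∑ i, ‖TC n (recordPairJ F θ k (recordK₀ F Mc k + n) B) i j.1‖ := sum_nonB0_le_sum k (recordK₀ F Mc k + n) (fun i => ‖TC n (recordPairJ F θ k (recordK₀ F Mc k + n) B) i j.1‖) fun _ => norm_nonneg _
      _ ≤ c₀ * K₀ (4 * 2 ^ 4) (2 * 4) := sum_norm_TC_col_le F hMc hP hc₀ hδ₀ n hcut j.1

end Carrier
/-! ## §4  ★★★ `RegClassP5` from the P0-ℂ letter, the (P2)-class letter, the nesting letter and the selector row -/
/-- ★★★ **`regClassP5_of_P0C_of_classP2_of_regNest_of_regSel` — (M7) IS GLUE**: `(∀F, P0HolExtAtRecordGL F) → (∀F, ClassP2Reg F) → (∀F, RegClassNestsUc F) → (∀F, RegSelSmoothOnClass F) →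
∀F, RegClassP5 F`.  Walk: demand `δ₀ := κ₀(64,8)`; P0C at `(Mc, a₀)` with the antecedent's TokE guard (`ε₁ := min a₁ (a₀∕B₃)`) gives `(α₀′, α₁′)` and, per `(ε₂₉, k)`, carriers with
`P0CarrierClauses`; the three class radii `ε₂` ((P2)-class at P0C's data), `εN` (nesting at `(α₀′, α₁′)`), `εA` (selector row), and the class-numerics radius `min (ε₁∕2) (1∕(53581824L⁶))` are
combined by `min`; `γ′ := c₀·K₀(64, 8)`.  At a class point: symmetry by ✓`isHermitian_recordPreckLoc_portVkAx_of_inRegClass`, positivity by §3's lower bound (`γ₀|w|² > 0` for `w ≠ 0`), the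
upper bound by §3. [cite: Balaban1987RG1, (2.11)–(2.12) pp.267–268, (1.18) p.263, (1.1)–(1.2) p.260, p.263 L5–13; Balaban1985Variational, Prop. 9 p.309, Thm 1 p.279; Balaban1985BackgroundPropagators,
(3.156)–(3.158) p.428; Balaban1988RG2Cluster, (1.26) p.8] -/
theorem regClassP5_of_P0C_of_classP2_of_regNest_of_regSel (hP : ∀ F, P0HolExtAtRecordGL F) (hC2 : ∀ F, ClassP2Reg F) (hN : ∀ F, RegClassNestsUc F)
    (hS : ∀ F, RegSelSmoothOnClass F) : ∀ F, RegClassP5 F := by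
  intro F
  obtain ⟨c₀, γ₀, γ₁, δ₁, hc₀, hγ₀, hγ, hδ₁, HP⟩ := hP F
  have hκ₈0 : 0 ≤ kappa₀ (4 * 2 ^ 4) (2 * 4) := kappa₀_nonneg (by norm_num) _
  have hδ₀pos : 0 < kappa₀ (4 * 2 ^ 4) (2 * 4) + 1 := by linarith
  obtain ⟨Mth, HM⟩ := HP (kappa₀ (4 * 2 ^ 4) (2 * 4) + 1) hδ₀pos
  obtain ⟨MN, HN⟩ := hN F
  obtain ⟨MS, HS⟩ := hS F
  refine ⟨max Mth (max MN MS), fun Mc hMc j c cc₀ c₁ B₃ B₃' a₀ a₁ hGuard h₁ h₂ h₃ hB₃ h₅ ha₀ ha₁ hT8 hT9 hUk hP9 hP9L ε₂₉ α₀ α₁ hε hα₀ hα₁ => ?_⟩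
  have hMth : Mth ≤ Mc := (le_max_left _ _).trans hMc
  have hMN : MN ≤ Mc := (le_max_left _ _).trans ((le_max_right _ _).trans hMc)
  have hMS : MS ≤ Mc := (le_max_right _ _).trans ((le_max_right _ _).trans hMc)
  -- the antecedent's TokE guard at `ε₁ := min a₁ (a₀ ∕ B₃)`
  have hB₃pos : 0 < B₃ := by
    have hL : (1 : ℝ) ≤ F.L := by exact_mod_cast F.hL.2.le
    nlinarith
  set ε₁ : ℝ := min a₁ (a₀ / B₃) with hε₁def
  have hε₁ : 0 < ε₁ := lt_min ha₁ (div_pos ha₀ hB₃pos)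
  have hTokE := hUk ε₁ hε₁ (min_le_left _ _) (by
    calc B₃ * min a₁ (a₀ / B₃) ≤ B₃ * (a₀ / B₃) := mul_le_mul_of_nonneg_left (min_le_right _ _) hB₃pos.le
      _ = a₀ := by field_simp)
  -- P0C's radii and carriers
  obtain ⟨α₀', α₁', hα₀', hα₁', HK⟩ := HM Mc hMth hGuard a₀ ha₀ ⟨_, hε₁, hTokE⟩
  -- the three class radii and the class-numerics radius
  obtain ⟨ε₂, hε₂, HC2⟩ := hC2 F Mc a₀ ε₂₉ (kappa₀ (4 * 2 ^ 4) (2 * 4) + 1) c₀ γ₀ γ₁ α₀' α₁' hGuard ha₀ hε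
  obtain ⟨εN, hεN, HNN⟩ := HN Mc hMN j c cc₀ c₁ B₃ B₃' a₀ a₁ hGuard h₁ h₂ h₃ hB₃ h₅ ha₀ ha₁ hT8 hT9 hUk hP9 hP9L ε₂₉ α₀' α₁' hε hα₀' hα₁'
  obtain ⟨εA, hεA, HA⟩ := HS Mc hMS j c cc₀ c₁ B₃ B₃' a₀ a₁ hGuard h₁ h₂ h₃ hB₃ h₅ ha₀ ha₁ hT8 hT9 hUk hP9 hP9L ε₂₉ hε
  set εcl : ℝ := min (ε₁ / 2) (1 / (53581824 * (F.L : ℝ) ^ 6)) with hεcldef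
  have hLpos : (0 : ℝ) < F.L := by exact_mod_cast F.hL.2.le.trans_lt' (by norm_num)
  have hεcl : 0 < εcl := lt_min (half_pos hε₁) (by positivity)
  set εn : ℝ := min (min ε₂ εN) (min εA εcl) with hεndef
  have hεn : 0 < εn := lt_min (lt_min hε₂ hεN) (lt_min hεA hεcl)
  have hK₀ : 0 < K₀ (4 * 2 ^ 4) (2 * 4) := K₀_pos _ _
  refine ⟨εn, c₀ * K₀ (4 * 2 ^ 4) (2 * 4), hεn, mul_pos hc₀ hK₀, fun ε₀ hε₀ hle k n B hB => ?_⟩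
  have hε₀2 : ε₀ ≤ ε₂ := hle.trans ((min_le_left _ _).trans (min_le_left _ _))
  have hε₀N : ε₀ ≤ εN := hle.trans ((min_le_left _ _).trans (min_le_right _ _))
  have hε₀A : ε₀ ≤ εA := hle.trans ((min_le_right _ _).trans (min_le_left _ _))
  have hε₀cl : ε₀ ≤ εcl := hle.trans ((min_le_right _ _).trans (min_le_right _ _))
  have hε₀c : ε₀ ≤ 1 / (53581824 * (F.L : ℝ) ^ 6) := hε₀cl.trans (min_le_right _ _)
  have hε₀ε : 2 * ε₀ ≤ ε₁ := by have := hε₀cl.trans (min_le_left _ _); linarith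
  obtain ⟨TC, TY, TZY, AdM, AdZ, hPC, -⟩ := HK ε₂₉ hε k
  have hcut : CutsInUc F Mc k α₀' α₁' a₀ ε₂₉ n B := HNN ε₀ hε₀ hε₀N k n B hB
  have hP2B := HC2 k TC TY TZY AdM AdZ hPC n B (inRegClass_mono hε₀2 hB)
  have hδ₀ : kappa₀ (4 * 2 ^ 4) (2 * 4) ≤ kappa₀ (4 * 2 ^ 4) (2 * 4) + 1 := by linarith
  -- (M7-sym)
  have hHerm := isHermitian_recordPreckLoc_portVkAx_of_inRegClass F a₀ ε₂₉ Mc k n hε₀ hε₀c hε₀ε (hTokE k n) hB (HA ε₀ hε₀ hε₀A k n B hB)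
  -- (M7-pos), (M7-up)
  have hlow := posLower_recordPreckLoc_of_P0C F hGuard hPC n hcut _ hP2B
  have hup := upper_recordPreckLoc_of_P0C F hGuard hPC hc₀.le hδ₀ n hcut _ hP2B
  refine ⟨Matrix.posDef_iff_dotProduct_mulVec.2 ⟨hHerm, fun w hw => ?_⟩, hup⟩
  have hww : 0 < w ⬝ᵥ w := by
    rw [dotProduct]  -- ∑ i, w i * w i
    obtain ⟨i, hi⟩ := Function.ne_iff.1 hw
    exact Finset.sum_pos' (fun l _ => mul_self_nonneg (w l)) ⟨i, Finset.mem_univ _, mul_self_pos.2 hi⟩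
  have h := hlow w
  rw [star_trivial]
  exact lt_of_lt_of_le (mul_pos hγ₀ hww) h

/-! ## §5  The closing frame of record re-keyed on the selector row -/
/-- ★★★ **⟨27930⟩ BY NAME FROM THE SEVEN LETTERS WITH `RegClassP5` REPLACED BY THE SELECTOR ROW**: `P0HolExtAtRecordGL`, `ClassP2Reg`, `RegSelSmoothOnClass`, `RegClassNestsUc`,
`FEChartLawReg`, `FEPolymerActivitiesReg`, `FEPolymerResummation` ⟹ `Summit.QuantumFields.YangMills.Theses.BalabanUVNodes.PortRecordRepresentationS1` (✓`portRecordRepresentationS1_of_regLetters`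
with `hC5 := regClassP5_of_P0C_of_classP2_of_regNest_of_regSel …`).  CONDITIONAL; asserted for nothing beyond its hypotheses.
[cite: Balaban1987RG1, Theorem 3 p.264, (1.6)–(1.21) pp.261–264, (2.1)–(2.14) pp.265–268; Balaban1988RG2Cluster, (2.11)–(2.13) p.14, Lemma 3 p.21; Balaban1985Variational, Prop. 9 p.309] -/
theorem portRecordRepresentationS1_of_regLetters_sel (hP0C : ∀ F, P0HolExtAtRecordGL F) (hC2 : ∀ F, ClassP2Reg F) (hS : ∀ F, RegSelSmoothOnClass F) (hN : ∀ F, RegClassNestsUc F)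
    (hS₁ : ∀ F, FEChartLawReg F) (hS₃ : ∀ F, FEPolymerActivitiesReg F) (hS₄ : ∀ F, FEPolymerResummation F) :
    Summit.QuantumFields.YangMills.Theses.BalabanUVNodes.PortRecordRepresentationS1 :=
  portRecordRepresentationS1_of_regLetters hP0C hC2 (regClassP5_of_P0C_of_classP2_of_regNest_of_regSel hP0C hC2 hN hS) hN hS₁ hS₃ hS₄

end Summit.QuantumFields.YangMills.Theorems.BalabanUVNodesPortS1

end
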